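import Mathlib.Analysis.InnerProductSpace.LinearMap
import Literature.MathematicalPhysics.QuantumFieldTheory.Balaban1983to89.B4Eq19LatticeCaccioppoli
import HarnessLib

/-!
# Route `UnitScaleTilt`, crux K1 «MinimiserStabilityRegPr» (stmt-QuantumFields-19200), EX row (5) `h3` (STOREY H), H2 pipeline (ii) — programme **H2-LOC**, brick **(C1):
# THE COVARIANT CACCIOPPOLI INEQUALITY ON `ℤ^d`** — the fibre-valued, background-covariant twin of lit ✓`B4Eq19LatticeCaccioppoli.caccioppoli`

Cell `ym3-torus` (HUMAN RULING D-0037; rung R3 = SU(2) YM₃ on T³ — NOT d = 4, NOT infinite volume, NOT a mass gap, NOT Clay).  Width seat `ym3-torus-px19` (gen 16);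
`--supports stmt-QuantumFields-19200 --as helper`; count-neutral; THEOREMS ONLY (0 `def`, 0 `sorry`, default heartbeats).

WHY (19200 evidence #56 `LOCATE-H2-FILE2-px19g16.md`).  STOREY H's Hölder letter `hHωt` (H7-R ∕ H8-R′) needs the η-scale ½-Hölder modulus of `ω₁ = R_S G′ᴾ_a D*_{U₀} x` for BOUNDED
data `x` on balls where the background is small ONLY LOCALLY (pipeline (i), `‖Ṽ − 1‖ ≤ 48ε₀η` on `tdist ≤ 12ℓ+4`).  The windowed re-port of the global bootstrap
(lit ✓`holderAdjRow_covariantResolvent_half`) cannot close (far bonds enter with `κ_far ≍ ℓ`), and the sup-norm two-background comparison (✓`two_background_gradient_comparison`)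
carries the η-gradient sup `G`, which is not K-free for bounded divergence data.  The road that localises honestly is interior regularity IN ENERGY NORMS at the curved background —
the covariant twin of lit's Campanato road `B4Eq19LatticeCaccioppoli → …DirichletReplacement → …HarmonicDecay → …CampanatoIteration → …PoincareMorrey → …InteriorHolder`.
THIS FILE is its first brick: the Caccioppoli inequality for the COVARIANT massive lattice operator with a unitary background `R(y, μ) : W ≃ₗᵢ W` (transport from `y + e_μ` to `y`),
fibre `W` any real inner-product space (the member's `W₂ = M₂(ℂ)` with `re⟪·,·⟫`), divergence-form datum `g` AND a site source `s` — ANY background (no smallness here).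

THE OPERATORS (written out; no `def`).  Covariant forward difference `(D_Rμ u)(y) = R(y,μ)u(y+e_μ) − u(y)`; covariant massive operator
`(L_R^κ u)(y) = Σ_μ (2u(y) − R(y,μ)u(y+e_μ) − R(y−e_μ,μ)⁻¹u(y−e_μ)) + κu(y)`; covariant divergence `(D*_R g)(y) = Σ_μ (R(y−e_μ,μ)⁻¹g(y−e_μ,μ) − g(y,μ))` — lattice units of
[Balaban1985BackgroundPropagators] (3.3), (3.23), (3.8) (`t = 1`; the member's `covLapSite`∕`DstarL2` are these times `ℓ²`∕`ℓ`, ✓`covLapSite_eq`).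

WHAT IS PROVED (ns `Summit.QuantumFields.YangMills.Theorems.Prop7CovariantLatticeCaccioppoli`).
* §1 `inner_map_symm_eq`, ★ `sum_inner_covLop` — COVARIANT SUMMATION BY PARTS: for `φ` vanishing off `Q_{R−1}(z)`,
  `Σ_{Q_R}⟪φ, L_R^κ u⟫ = Σ_{Q_R} Σ_μ ⟪D_Rμ φ, D_Rμ u⟫ + κ Σ_{Q_R}⟪φ, u⟫` (twin of lit ✓`sum_mul_lop`; `R` an isometry); ★ `sum_inner_covDvg` — `Σ⟪φ, D*_R g⟫ = Σ Σ_μ ⟪D_Rμ φ, g_μ⟫`.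
* §2 `pointwise_young_inner` — the bond-by-bond Young inequality of lit ✓`pointwise_young` in a real inner-product space.
* §3 ★★★ `covariant_caccioppoli` — `κ ≥ 0`, `ρ ≥ 0`, `s ≥ 1`, `L_R^κ u = D*_R g + src` on `Q_{ρ+s}(z)` ⟹
  `Σ_{Q_ρ(z)} Σ_μ ‖D_Rμ u‖² ≤ (14d∕s²)·Σ_{Q_{ρ+s+2}(z)}‖u‖² + 4·Σ_{Q_{ρ+s+1}(z)} Σ_μ‖g‖² + 2·Σ_{Q_{ρ+s+1}(z)}‖u‖·‖src‖` — lit's constants, plus the source term;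
  ★ `covariant_caccioppoli_harmonic` (`g = 0`, `src = 0`).
HYP-SAT (★★OWNER RULING №42).  Hypotheses: `κ ≥ 0`, radii, and ONE equation between displayed terms (inhabited: `u = 0`; at the member by every solution of
`covLapSite V u + q = DstarL2 V f` after division by `ℓ²`).  No background smallness, no gauge letter, no `Prop` placeholder; the conclusion is a real inequality.
HONEST SCOPE.  [folklore] lattice analysis ([Giaquinta1984] Ch. III §2 (2.3)–(2.4)); bricks (C2)–(C6) of H2-LOC (flat Dirichlet comparison, iteration, Morrey, torus transfer, the
`ω₁` knit) are NOT here; nothing of H2, `h3`, norm_G, EX, 19200 or the rung is proved; the Yang–Mills mass gap is NOT proved.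

References: T. Bałaban, CMP **99** (1985) 389–434 [Balaban1985BackgroundPropagators] ((3.3) p.391, (3.8) p.392, (3.23) p.394, Thm 3.1 (3.43) p.398); CMP **96** (1984) 223–250
[Balaban1984PropagatorsII] ((1.9) p.226); M. Giaquinta, *Multiple integrals in the calculus of variations and nonlinear elliptic systems* (1983) [Giaquinta1984] (Ch. III §2).
-/

set_option autoImplicit false

noncomputable section

open scoped BigOperators InnerProductSpace
open Finset

namespace Summit.QuantumFields.YangMills.Theorems.Prop7CovariantLatticeCaccioppoli

open Literature.MathematicalPhysics.QuantumFieldTheory.Balaban1983to89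
open B4Eq19LatticeOperators (Zd unitVec box mem_box box_mono box_subset_box add_unitVec_mem_box abs_unitVec_apply_le sum_box_add_right sum_box_shift_of_support)
open B4Eq19LatticeCaccioppoli (exists_cutoff)

variable {d : ℕ} {W : Type*} [NormedAddCommGroup W] [InnerProductSpace ℝ W]

/-! ## §1 Covariant summation by parts on `ℤ^d` -/

/-- For a linear isometric isomorphism `R` of a real inner-product space: `⟪R a, b⟫ = ⟪a, R⁻¹ b⟫`. [folklore] [cite: Balaban1985BackgroundPropagators, (3.8) p.392] -/
theorem inner_map_symm_eq (R : W ≃ₗᵢ[ℝ] W) (a b : W) : ⟪R a, b⟫_ℝ = ⟪a, R.symm b⟫_ℝ := by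
  conv_lhs => rw [← R.apply_symm_apply b]
  rw [LinearIsometryEquiv.inner_map_map]

/-- ★ **COVARIANT SUMMATION BY PARTS for `L_R^κ`**: for a test function `φ` vanishing off `Q_{R−1}(z)`, any `u`, and any unitary background `R`,
`Σ_{y ∈ Q_R(z)} ⟪φ(y), (L_R^κ u)(y)⟫ = Σ_{y ∈ Q_R(z)} Σ_μ ⟪(D_Rμ φ)(y), (D_Rμ u)(y)⟫ + κ·Σ_{y ∈ Q_R(z)} ⟪φ(y), u(y)⟫` — the covariant discrete Dirichlet form
(lit ✓`B4Eq19LatticeOperators.sum_mul_lop` at `R = 1`). [folklore] [cite: Balaban1985BackgroundPropagators, (3.23) p.394, (3.8) p.392; Giaquinta1984, Ch. III §2 (2.3) p.77] -/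
theorem sum_inner_covLop (R : Zd d → Fin d → (W ≃ₗᵢ[ℝ] W)) (κ : ℝ) (φ u : Zd d → W) (z : Zd d) (Rr : ℤ)
    (hφ : ∀ y ∉ box z (Rr - 1), φ y = 0) :
    ∑ y ∈ box z Rr, ⟪φ y, (∑ μ, ((2 : ℝ) • u y - R y μ (u (y + unitVec μ)) - (R (y - unitVec μ) μ).symm (u (y - unitVec μ)))) + κ • u y⟫_ℝ
      = (∑ y ∈ box z Rr, ∑ μ, ⟪R y μ (φ (y + unitVec μ)) - φ y, R y μ (u (y + unitVec μ)) - u y⟫_ℝ) + κ * ∑ y ∈ box z Rr, ⟪φ y, u y⟫_ℝ := by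
  -- the shifted sum: `Σ_y (⟪φ y, u y⟫ − ⟪φ y, S_{y−e_μ} u(y−e_μ)⟫)` read at `y + e_μ`
  have key : ∀ μ : Fin d, ∑ y ∈ box z Rr, (⟪φ y, u y⟫_ℝ - ⟪φ y, (R (y - unitVec μ) μ).symm (u (y - unitVec μ))⟫_ℝ) =
      ∑ y ∈ box z Rr, (⟪φ (y + unitVec μ), u (y + unitVec μ)⟫_ℝ - ⟪φ (y + unitVec μ), (R y μ).symm (u y)⟫_ℝ) := by
    intro μ
    have h := sum_box_shift_of_support (F := fun y => ⟪φ y, u y⟫_ℝ - ⟪φ y, (R (y - unitVec μ) μ).symm (u (y - unitVec μ))⟫_ℝ) (z := z) (R := Rr)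
      (fun y hy => by simp only [hφ y hy, inner_zero_left, sub_zero]) (unitVec μ) (abs_unitVec_apply_le μ)
    simp only [add_sub_cancel_right] at h
    exact h.symm
  -- expand the covariant Dirichlet form bond by bond
  have hbond : ∀ (y : Zd d) (μ : Fin d), ⟪R y μ (φ (y + unitVec μ)) - φ y, R y μ (u (y + unitVec μ)) - u y⟫_ℝ =
      (⟪φ (y + unitVec μ), u (y + unitVec μ)⟫_ℝ - ⟪φ (y + unitVec μ), (R y μ).symm (u y)⟫_ℝ) + (⟪φ y, u y⟫_ℝ - ⟪φ y, R y μ (u (y + unitVec μ))⟫_ℝ) := by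
    intro y μ
    rw [inner_sub_left, inner_sub_right, inner_sub_right, LinearIsometryEquiv.inner_map_map, inner_map_symm_eq]
    ring
  calc ∑ y ∈ box z Rr, ⟪φ y, (∑ μ, ((2 : ℝ) • u y - R y μ (u (y + unitVec μ)) - (R (y - unitVec μ) μ).symm (u (y - unitVec μ)))) + κ • u y⟫_ℝ
      = ∑ y ∈ box z Rr, ((∑ μ, ((⟪φ y, u y⟫_ℝ - ⟪φ y, (R (y - unitVec μ) μ).symm (u (y - unitVec μ))⟫_ℝ) +
          (⟪φ y, u y⟫_ℝ - ⟪φ y, R y μ (u (y + unitVec μ))⟫_ℝ))) + κ * ⟪φ y, u y⟫_ℝ) := by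
        refine Finset.sum_congr rfl fun y _ => ?_
        rw [inner_add_right, inner_sum, real_inner_smul_right]
        congr 1
        refine Finset.sum_congr rfl fun μ _ => ?_
        rw [inner_sub_right, inner_sub_right, real_inner_smul_right]
        ring
    _ = (∑ μ, ((∑ y ∈ box z Rr, (⟪φ y, u y⟫_ℝ - ⟪φ y, (R (y - unitVec μ) μ).symm (u (y - unitVec μ))⟫_ℝ)) +
          ∑ y ∈ box z Rr, (⟪φ y, u y⟫_ℝ - ⟪φ y, R y μ (u (y + unitVec μ))⟫_ℝ))) + κ * ∑ y ∈ box z Rr, ⟪φ y, u y⟫_ℝ := by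
        rw [Finset.sum_add_distrib, Finset.sum_comm, ← Finset.mul_sum]
        congr 1
        exact Finset.sum_congr rfl fun μ _ => Finset.sum_add_distrib
    _ = (∑ μ, ∑ y ∈ box z Rr, ⟪R y μ (φ (y + unitVec μ)) - φ y, R y μ (u (y + unitVec μ)) - u y⟫_ℝ) + κ * ∑ y ∈ box z Rr, ⟪φ y, u y⟫_ℝ := by
        congr 1
        refine Finset.sum_congr rfl fun μ _ => ?_
        rw [key μ, ← Finset.sum_add_distrib]
        exact Finset.sum_congr rfl fun y _ => (hbond y μ).symm
    _ = _ := by rw [Finset.sum_comm]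

/-- ★ **COVARIANT SUMMATION BY PARTS for the divergence**: for `φ` vanishing off `Q_{R−1}(z)`,
`Σ_{y ∈ Q_R(z)} ⟪φ(y), (D*_R g)(y)⟫ = Σ_{y ∈ Q_R(z)} Σ_μ ⟪(D_Rμ φ)(y), g(y, μ)⟫` (`D*_R` is the adjoint of `D_R`; lit ✓`sum_mul_dvg` at `R = 1`).
[folklore] [cite: Balaban1985BackgroundPropagators, (3.8) p.392] -/
theorem sum_inner_covDvg (R : Zd d → Fin d → (W ≃ₗᵢ[ℝ] W)) (φ : Zd d → W) (g : Zd d → Fin d → W) (z : Zd d) (Rr : ℤ)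
    (hφ : ∀ y ∉ box z (Rr - 1), φ y = 0) :
    ∑ y ∈ box z Rr, ⟪φ y, ∑ μ, ((R (y - unitVec μ) μ).symm (g (y - unitVec μ) μ) - g y μ)⟫_ℝ
      = ∑ y ∈ box z Rr, ∑ μ, ⟪R y μ (φ (y + unitVec μ)) - φ y, g y μ⟫_ℝ := by
  have key : ∀ μ : Fin d, ∑ y ∈ box z Rr, ⟪φ y, (R (y - unitVec μ) μ).symm (g (y - unitVec μ) μ)⟫_ℝ =
      ∑ y ∈ box z Rr, ⟪φ (y + unitVec μ), (R y μ).symm (g y μ)⟫_ℝ := by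
    intro μ
    have h := sum_box_shift_of_support (F := fun y => ⟪φ y, (R (y - unitVec μ) μ).symm (g (y - unitVec μ) μ)⟫_ℝ) (z := z) (R := Rr)
      (fun y hy => by simp only [hφ y hy, inner_zero_left]) (unitVec μ) (abs_unitVec_apply_le μ)
    simp only [add_sub_cancel_right] at h
    exact h.symm
  calc ∑ y ∈ box z Rr, ⟪φ y, ∑ μ, ((R (y - unitVec μ) μ).symm (g (y - unitVec μ) μ) - g y μ)⟫_ℝ
      = ∑ y ∈ box z Rr, ∑ μ, (⟪φ y, (R (y - unitVec μ) μ).symm (g (y - unitVec μ) μ)⟫_ℝ - ⟪φ y, g y μ⟫_ℝ) := by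
        refine Finset.sum_congr rfl fun y _ => ?_
        rw [inner_sum]
        exact Finset.sum_congr rfl fun μ _ => inner_sub_right _ _ _
    _ = ∑ μ, ((∑ y ∈ box z Rr, ⟪φ y, (R (y - unitVec μ) μ).symm (g (y - unitVec μ) μ)⟫_ℝ) - ∑ y ∈ box z Rr, ⟪φ y, g y μ⟫_ℝ) := by
        rw [Finset.sum_comm]
        exact Finset.sum_congr rfl fun μ _ => Finset.sum_sub_distrib _ _
    _ = ∑ μ, ∑ y ∈ box z Rr, ⟪R y μ (φ (y + unitVec μ)) - φ y, g y μ⟫_ℝ := by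
        refine Finset.sum_congr rfl fun μ _ => ?_
        rw [key μ, ← Finset.sum_sub_distrib]
        refine Finset.sum_congr rfl fun y _ => ?_
        rw [inner_sub_left, inner_map_symm_eq]
    _ = _ := Finset.sum_comm

/-! ## §2 The pointwise Young-type inequality, inner-product edition -/

/-- The bond-by-bond inequality behind Caccioppoli, in a real inner-product space: with `0 ≤ χ₀, χ₁ ≤ 1`, `|χ₁ − χ₀| ≤ δ`, `Du = u₁′ − u₀`,
`−(χ₁+χ₀)(χ₁−χ₀)⟪u₀, Du⟫ + χ₁²⟪Du, g⟫ + (χ₁+χ₀)(χ₁−χ₀)⟪u₀, g⟫ ≤ ½(χ₁‖Du‖)² + (13∕2)δ²‖u₀‖² + ½δ²‖u₁′‖² + 2‖g‖²` (lit ✓`pointwise_young` is the case `W = ℝ`).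
[folklore] [cite: Giaquinta1984, Ch. III §2 (2.4) p.77] -/
theorem pointwise_young_inner {χ₀ χ₁ δ : ℝ} (u₀ u₁' g : W) (h0 : 0 ≤ χ₀) (h0' : χ₀ ≤ 1) (h1 : 0 ≤ χ₁) (h1' : χ₁ ≤ 1) (hδ : |χ₁ - χ₀| ≤ δ) :
    -((χ₁ + χ₀) * (χ₁ - χ₀) * ⟪u₀, u₁' - u₀⟫_ℝ) + χ₁ ^ 2 * ⟪u₁' - u₀, g⟫_ℝ + (χ₁ + χ₀) * (χ₁ - χ₀) * ⟪u₀, g⟫_ℝ ≤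
      (1 / 2) * (χ₁ * ‖u₁' - u₀‖) ^ 2 + (13 / 2) * δ ^ 2 * ‖u₀‖ ^ 2 + (1 / 2) * δ ^ 2 * ‖u₁'‖ ^ 2 + 2 * ‖g‖ ^ 2 := by
  have hδ0 : 0 ≤ δ := (abs_nonneg _).trans hδ
  set e := χ₁ - χ₀ with he
  set Du := u₁' - u₀ with hDu
  set a := χ₁ * ‖Du‖ with ha
  have heabs : |e| ≤ δ := hδ
  have he2 : e ^ 2 ≤ δ ^ 2 := by rw [← sq_abs e]; exact pow_le_pow_left₀ (abs_nonneg e) heabs 2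
  have hsum : χ₁ + χ₀ = 2 * χ₁ - e := by rw [he]; ring
  have n0 := norm_nonneg u₀
  have n1 := norm_nonneg u₁'
  have nD := norm_nonneg Du
  have ng := norm_nonneg g
  have ha0 : 0 ≤ a := mul_nonneg h1 nD
  -- the three inner products against norms
  have hp : |⟪u₀, Du⟫_ℝ| ≤ ‖u₀‖ * ‖Du‖ := abs_real_inner_le_norm _ _
  have hq : |⟪Du, g⟫_ℝ| ≤ ‖Du‖ * ‖g‖ := abs_real_inner_le_norm _ _
  have hr : |⟪u₀, g⟫_ℝ| ≤ ‖u₀‖ * ‖g‖ := abs_real_inner_le_norm _ _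
  have hDun : ‖Du‖ ≤ ‖u₁'‖ + ‖u₀‖ := by rw [hDu]; exact norm_sub_le _ _
  -- `|⟪u₀, Du⟫| ≤ (3/2)‖u₀‖² + (1/2)‖u₁′‖²`
  have hpA : |⟪u₀, Du⟫_ℝ| ≤ (3 / 2) * ‖u₀‖ ^ 2 + (1 / 2) * ‖u₁'‖ ^ 2 := by
    have s1 := two_mul_le_add_sq ‖u₀‖ ‖u₁'‖
    calc |⟪u₀, Du⟫_ℝ| ≤ ‖u₀‖ * ‖Du‖ := hp
      _ ≤ ‖u₀‖ * (‖u₁'‖ + ‖u₀‖) := mul_le_mul_of_nonneg_left hDun n0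
      _ = ‖u₀‖ * ‖u₁'‖ + ‖u₀‖ ^ 2 := by ring
      _ ≤ (3 / 2) * ‖u₀‖ ^ 2 + (1 / 2) * ‖u₁'‖ ^ 2 := by linarith
  -- term 1
  have t1 : -((χ₁ + χ₀) * e * ⟪u₀, Du⟫_ℝ) ≤ (1 / 4) * a ^ 2 + 4 * δ ^ 2 * ‖u₀‖ ^ 2 + δ ^ 2 * ((3 / 2) * ‖u₀‖ ^ 2 + (1 / 2) * ‖u₁'‖ ^ 2) := by
    have e1 : -((χ₁ + χ₀) * e * ⟪u₀, Du⟫_ℝ) = -(2 * χ₁ * e * ⟪u₀, Du⟫_ℝ) + e ^ 2 * ⟪u₀, Du⟫_ℝ := by rw [hsum]; ring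
    rw [e1]
    have i1 : -(2 * χ₁ * e * ⟪u₀, Du⟫_ℝ) ≤ (1 / 4) * a ^ 2 + 4 * δ ^ 2 * ‖u₀‖ ^ 2 := by
      have s2 := two_mul_le_add_sq (a / 2) (2 * (δ * ‖u₀‖))
      calc -(2 * χ₁ * e * ⟪u₀, Du⟫_ℝ) ≤ |2 * χ₁ * e * ⟪u₀, Du⟫_ℝ| := neg_le_abs _
        _ = 2 * χ₁ * |e| * |⟪u₀, Du⟫_ℝ| := by
            rw [abs_mul, abs_mul, abs_mul, abs_of_nonneg (by norm_num : (0:ℝ) ≤ 2), abs_of_nonneg h1]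
        _ ≤ 2 * χ₁ * δ * (‖u₀‖ * ‖Du‖) :=
            mul_le_mul (mul_le_mul_of_nonneg_left heabs (by positivity)) hp (abs_nonneg _) (by positivity)
        _ = 2 * (a / 2) * (2 * (δ * ‖u₀‖)) := by rw [ha]; ring
        _ ≤ (a / 2) ^ 2 + (2 * (δ * ‖u₀‖)) ^ 2 := s2
        _ = (1 / 4) * a ^ 2 + 4 * δ ^ 2 * ‖u₀‖ ^ 2 := by ring
    have i4 : e ^ 2 * ⟪u₀, Du⟫_ℝ ≤ δ ^ 2 * ((3 / 2) * ‖u₀‖ ^ 2 + (1 / 2) * ‖u₁'‖ ^ 2) :=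
      calc e ^ 2 * ⟪u₀, Du⟫_ℝ ≤ e ^ 2 * |⟪u₀, Du⟫_ℝ| := mul_le_mul_of_nonneg_left (le_abs_self _) (sq_nonneg _)
        _ ≤ δ ^ 2 * ((3 / 2) * ‖u₀‖ ^ 2 + (1 / 2) * ‖u₁'‖ ^ 2) := mul_le_mul he2 hpA (abs_nonneg _) (sq_nonneg _)
    linarith
  -- term 2
  have t2 : χ₁ ^ 2 * ⟪Du, g⟫_ℝ ≤ (1 / 4) * a ^ 2 + ‖g‖ ^ 2 := by
    have s3 := two_mul_le_add_sq (a / 2) ‖g‖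
    have e2 : χ₁ ^ 2 * ⟪Du, g⟫_ℝ ≤ χ₁ * (a * ‖g‖) :=
      calc χ₁ ^ 2 * ⟪Du, g⟫_ℝ ≤ χ₁ ^ 2 * (‖Du‖ * ‖g‖) := mul_le_mul_of_nonneg_left ((le_abs_self _).trans hq) (sq_nonneg _)
        _ = χ₁ * (a * ‖g‖) := by rw [ha]; ring
    have i1 : a * ‖g‖ ≤ (1 / 4) * a ^ 2 + ‖g‖ ^ 2 := by
      calc a * ‖g‖ = 2 * (a / 2) * ‖g‖ := by ring
        _ ≤ (a / 2) ^ 2 + ‖g‖ ^ 2 := s3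
        _ = (1 / 4) * a ^ 2 + ‖g‖ ^ 2 := by ring
    have i2 : χ₁ * (a * ‖g‖) ≤ 1 * (a * ‖g‖) := mul_le_mul_of_nonneg_right h1' (mul_nonneg ha0 ng)
    linarith
  -- term 3
  have t3 : (χ₁ + χ₀) * e * ⟪u₀, g⟫_ℝ ≤ δ ^ 2 * ‖u₀‖ ^ 2 + ‖g‖ ^ 2 := by
    have hb : |χ₁ + χ₀| ≤ 2 := abs_le.2 ⟨by linarith, by linarith⟩
    have s4 := two_mul_le_add_sq (δ * ‖u₀‖) ‖g‖
    have hA : |e * ⟪u₀, g⟫_ℝ| ≤ (1 / 2) * (δ ^ 2 * ‖u₀‖ ^ 2 + ‖g‖ ^ 2) := by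
      rw [abs_mul]
      calc |e| * |⟪u₀, g⟫_ℝ| ≤ δ * (‖u₀‖ * ‖g‖) := mul_le_mul heabs hr (abs_nonneg _) hδ0
        _ = (1 / 2) * (2 * (δ * ‖u₀‖) * ‖g‖) := by ring
        _ ≤ (1 / 2) * ((δ * ‖u₀‖) ^ 2 + ‖g‖ ^ 2) := by linarith
        _ = (1 / 2) * (δ ^ 2 * ‖u₀‖ ^ 2 + ‖g‖ ^ 2) := by ring
    calc (χ₁ + χ₀) * e * ⟪u₀, g⟫_ℝ = (χ₁ + χ₀) * (e * ⟪u₀, g⟫_ℝ) := by ring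
      _ ≤ |χ₁ + χ₀| * |e * ⟪u₀, g⟫_ℝ| := by rw [← abs_mul]; exact le_abs_self _
      _ ≤ 2 * ((1 / 2) * (δ ^ 2 * ‖u₀‖ ^ 2 + ‖g‖ ^ 2)) := mul_le_mul hb hA (abs_nonneg _) (by norm_num)
      _ = δ ^ 2 * ‖u₀‖ ^ 2 + ‖g‖ ^ 2 := by ring
  have hfin : (1 / 4) * a ^ 2 + (1 / 4) * a ^ 2 = (1 / 2) * (χ₁ * ‖u₁' - u₀‖) ^ 2 := by rw [ha, hDu]; ring
  linarith

/-! ## §3 ★★★ The covariant Caccioppoli inequality -/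

/-- ★★★ **THE COVARIANT CACCIOPPOLI INEQUALITY ON `ℤ^d`** (ANY unitary background).  Let `κ ≥ 0`, `ρ ≥ 0`, `s ≥ 1`, and let `u : ℤ^d → W` solve, at every point of `Q_{ρ+s}(z)`,
`L_R^κ u = D*_R g + src`, i.e. `Σ_μ (2u(y) − R(y,μ)u(y+e_μ) − R(y−e_μ,μ)⁻¹u(y−e_μ)) + κu(y) = Σ_μ (R(y−e_μ,μ)⁻¹g(y−e_μ,μ) − g(y,μ)) + src(y)`.  Then
`Σ_{y ∈ Q_ρ(z)} Σ_μ ‖R(y,μ)u(y+e_μ) − u(y)‖² ≤ (14d∕s²)·Σ_{Q_{ρ+s+2}(z)}‖u‖² + 4·Σ_{Q_{ρ+s+1}(z)} Σ_μ‖g‖² + 2·Σ_{Q_{ρ+s+1}(z)}‖u‖·‖src‖`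
(test against `χ²u` with lit ✓`exists_cutoff`, §1, absorb by §2; the mass term has the good sign; `‖R(y,μ)u(y+e_μ)‖ = ‖u(y+e_μ)‖`).
[folklore] [cite: Giaquinta1984, Ch. III §2 (2.3)–(2.4) p.77; Balaban1985BackgroundPropagators, (3.23) p.394, Thm 3.1 (3.43) p.398; Balaban1984PropagatorsII, (1.9) p.226] -/
theorem covariant_caccioppoli (R : Zd d → Fin d → (W ≃ₗᵢ[ℝ] W)) {κ : ℝ} (hκ : 0 ≤ κ) (u : Zd d → W) (g : Zd d → Fin d → W) (src : Zd d → W)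
    (z : Zd d) {ρ s : ℤ} (hρ : 0 ≤ ρ) (hs : 1 ≤ s)
    (hEq : ∀ y ∈ box z (ρ + s),
      (∑ μ, ((2 : ℝ) • u y - R y μ (u (y + unitVec μ)) - (R (y - unitVec μ) μ).symm (u (y - unitVec μ)))) + κ • u y
        = (∑ μ, ((R (y - unitVec μ) μ).symm (g (y - unitVec μ) μ) - g y μ)) + src y) :
    ∑ y ∈ box z ρ, ∑ μ, ‖R y μ (u (y + unitVec μ)) - u y‖ ^ 2 ≤
      (14 * d / (s : ℝ) ^ 2) * ∑ y ∈ box z (ρ + s + 2), ‖u y‖ ^ 2 + 4 * ∑ y ∈ box z (ρ + s + 1), ∑ μ, ‖g y μ‖ ^ 2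
        + 2 * ∑ y ∈ box z (ρ + s + 1), ‖u y‖ * ‖src y‖ := by
  classical
  obtain ⟨χ, hχ0, hχ1, hχin, hχout, hχlip⟩ := exists_cutoff z hρ hs
  set Rr : ℤ := ρ + s + 1 with hR
  have hs0 : (0 : ℝ) < s := by exact_mod_cast (show (0 : ℤ) < s by linarith)
  set δ : ℝ := 1 / s with hδ
  have hδ0 : 0 ≤ δ := by positivity
  -- covariant differences of `u`
  set Du : Zd d → Fin d → W := fun y μ => R y μ (u (y + unitVec μ)) - u y with hDu
  -- the test function `φ = χ²u` vanishes off `Q_{R-1}(z)`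
  set φ : Zd d → W := fun y => (χ y ^ 2) • u y with hφ
  have hφ0 : ∀ y ∉ box z (Rr - 1), φ y = 0 := by
    intro y hy
    have : χ y = 0 := hχout y (by rw [hR] at hy; simpa using hy)
    simp [hφ, this]
  -- summation by parts on both sides of the equation
  have hL := sum_inner_covLop R κ φ u z Rr hφ0
  have hD := sum_inner_covDvg R φ g z Rr hφ0
  have hEq' : ∑ y ∈ box z Rr, ⟪φ y, (∑ μ, ((2 : ℝ) • u y - R y μ (u (y + unitVec μ)) - (R (y - unitVec μ) μ).symm (u (y - unitVec μ)))) + κ • u y⟫_ℝ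
      = ∑ y ∈ box z Rr, ⟪φ y, ∑ μ, ((R (y - unitVec μ) μ).symm (g (y - unitVec μ) μ) - g y μ)⟫_ℝ + ∑ y ∈ box z Rr, ⟪φ y, src y⟫_ℝ := by
    rw [← Finset.sum_add_distrib]
    refine Finset.sum_congr rfl fun y _ => ?_
    by_cases hy : y ∈ box z (Rr - 1)
    · rw [hEq y (by rw [hR] at hy; simpa using hy), inner_add_right]
    · rw [hφ0 y hy, inner_zero_left, inner_zero_left, inner_zero_left, add_zero]
  -- the covariant difference of `φ`
  have hDφ : ∀ (y : Zd d) (μ : Fin d), R y μ (φ (y + unitVec μ)) - φ y =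
      (χ (y + unitVec μ) ^ 2) • Du y μ + ((χ (y + unitVec μ) + χ y) * (χ (y + unitVec μ) - χ y)) • u y := by
    intro y μ
    simp only [hφ, hDu, LinearIsometryEquiv.map_smul, smul_sub]
    rw [show (χ (y + unitVec μ) + χ y) * (χ (y + unitVec μ) - χ y) = χ (y + unitVec μ) ^ 2 - χ y ^ 2 by ring, sub_smul]
    abel
  have hmass : 0 ≤ κ * ∑ y ∈ box z Rr, ⟪φ y, u y⟫_ℝ := by
    apply mul_nonneg hκ
    apply Finset.sum_nonneg
    intro y _
    simp only [hφ, real_inner_smul_left, real_inner_self_eq_norm_sq]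
    positivity
  -- the source pairing
  have hsrc : ∑ y ∈ box z Rr, ⟪φ y, src y⟫_ℝ ≤ ∑ y ∈ box z Rr, ‖u y‖ * ‖src y‖ := by
    refine Finset.sum_le_sum fun y _ => ?_
    simp only [hφ, real_inner_smul_left]
    have h1 : χ y ^ 2 ≤ 1 := by nlinarith [hχ0 y, hχ1 y]
    have h2 : ⟪u y, src y⟫_ℝ ≤ ‖u y‖ * ‖src y‖ := real_inner_le_norm _ _
    have h3 : 0 ≤ ‖u y‖ * ‖src y‖ := by positivity
    nlinarith [sq_nonneg (χ y)]
  -- I ≤ Σ (pointwise RHS) + source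
  have hI : ∑ y ∈ box z Rr, ∑ μ, (χ (y + unitVec μ) * ‖Du y μ‖) ^ 2 ≤
      ∑ y ∈ box z Rr, ∑ μ, ((1 / 2) * (χ (y + unitVec μ) * ‖Du y μ‖) ^ 2 + (13 / 2) * δ ^ 2 * ‖u y‖ ^ 2 +
        (1 / 2) * δ ^ 2 * ‖R y μ (u (y + unitVec μ))‖ ^ 2 + 2 * ‖g y μ‖ ^ 2) + ∑ y ∈ box z Rr, ‖u y‖ * ‖src y‖ := by
    have h2 : ∑ y ∈ box z Rr, ∑ μ, ⟪R y μ (φ (y + unitVec μ)) - φ y, Du y μ⟫_ℝ + κ * ∑ y ∈ box z Rr, ⟪φ y, u y⟫_ℝ =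
        ∑ y ∈ box z Rr, ∑ μ, ⟪R y μ (φ (y + unitVec μ)) - φ y, g y μ⟫_ℝ + ∑ y ∈ box z Rr, ⟪φ y, src y⟫_ℝ := by rw [← hL, hEq', hD]
    have e1 : ∑ y ∈ box z Rr, ∑ μ, ⟪R y μ (φ (y + unitVec μ)) - φ y, Du y μ⟫_ℝ =
        ∑ y ∈ box z Rr, ∑ μ, (χ (y + unitVec μ) * ‖Du y μ‖) ^ 2 +
          ∑ y ∈ box z Rr, ∑ μ, (χ (y + unitVec μ) + χ y) * (χ (y + unitVec μ) - χ y) * ⟪u y, Du y μ⟫_ℝ := by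
      rw [← Finset.sum_add_distrib]
      refine Finset.sum_congr rfl fun y _ => ?_
      rw [← Finset.sum_add_distrib]
      refine Finset.sum_congr rfl fun μ _ => ?_
      rw [hDφ, inner_add_left, real_inner_smul_left, real_inner_smul_left, real_inner_self_eq_norm_sq]
      ring
    have e2 : ∑ y ∈ box z Rr, ∑ μ, ⟪R y μ (φ (y + unitVec μ)) - φ y, g y μ⟫_ℝ =
        ∑ y ∈ box z Rr, ∑ μ, (χ (y + unitVec μ) ^ 2 * ⟪Du y μ, g y μ⟫_ℝ + (χ (y + unitVec μ) + χ y) * (χ (y + unitVec μ) - χ y) * ⟪u y, g y μ⟫_ℝ) := by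
      refine Finset.sum_congr rfl fun y _ => Finset.sum_congr rfl fun μ _ => ?_
      rw [hDφ, inner_add_left, real_inner_smul_left, real_inner_smul_left]
    rw [e1, e2] at h2
    have h3 : ∑ y ∈ box z Rr, ∑ μ, (χ (y + unitVec μ) * ‖Du y μ‖) ^ 2 ≤
        ∑ y ∈ box z Rr, ∑ μ, (-((χ (y + unitVec μ) + χ y) * (χ (y + unitVec μ) - χ y) * ⟪u y, Du y μ⟫_ℝ) +
          χ (y + unitVec μ) ^ 2 * ⟪Du y μ, g y μ⟫_ℝ + (χ (y + unitVec μ) + χ y) * (χ (y + unitVec μ) - χ y) * ⟪u y, g y μ⟫_ℝ)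
          + ∑ y ∈ box z Rr, ⟪φ y, src y⟫_ℝ := by
      have e3 : ∑ y ∈ box z Rr, ∑ μ, (-((χ (y + unitVec μ) + χ y) * (χ (y + unitVec μ) - χ y) * ⟪u y, Du y μ⟫_ℝ) +
          χ (y + unitVec μ) ^ 2 * ⟪Du y μ, g y μ⟫_ℝ + (χ (y + unitVec μ) + χ y) * (χ (y + unitVec μ) - χ y) * ⟪u y, g y μ⟫_ℝ) =
          ∑ y ∈ box z Rr, ∑ μ, (χ (y + unitVec μ) ^ 2 * ⟪Du y μ, g y μ⟫_ℝ + (χ (y + unitVec μ) + χ y) * (χ (y + unitVec μ) - χ y) * ⟪u y, g y μ⟫_ℝ) -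
          ∑ y ∈ box z Rr, ∑ μ, (χ (y + unitVec μ) + χ y) * (χ (y + unitVec μ) - χ y) * ⟪u y, Du y μ⟫_ℝ := by
        rw [← Finset.sum_sub_distrib]
        refine Finset.sum_congr rfl fun y _ => ?_
        rw [← Finset.sum_sub_distrib]
        refine Finset.sum_congr rfl fun μ _ => ?_
        ring
      rw [e3]
      linarith
    refine h3.trans (add_le_add (Finset.sum_le_sum fun y _ => Finset.sum_le_sum fun μ _ => ?_) hsrc)
    have := pointwise_young_inner (u y) (R y μ (u (y + unitVec μ))) (g y μ) (hχ0 y) (hχ1 y) (hχ0 (y + unitVec μ)) (hχ1 (y + unitVec μ)) (hχlip y μ)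
    simp only [hDu] at this ⊢
    linarith
  -- absorb: I ≤ 13 δ² Σ ‖u‖² + δ² Σ ‖u₊‖² + 4 Σ ‖g‖² + 2 Σ ‖u‖‖src‖
  have hI' : ∑ y ∈ box z Rr, ∑ μ, (χ (y + unitVec μ) * ‖Du y μ‖) ^ 2 ≤
      13 * δ ^ 2 * ∑ y ∈ box z Rr, ∑ μ : Fin d, ‖u y‖ ^ 2 + δ ^ 2 * ∑ y ∈ box z Rr, ∑ μ, ‖u (y + unitVec μ)‖ ^ 2 +
        4 * ∑ y ∈ box z Rr, ∑ μ, ‖g y μ‖ ^ 2 + 2 * ∑ y ∈ box z Rr, ‖u y‖ * ‖src y‖ := by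
    have e1 : ∑ y ∈ box z Rr, ∑ μ, ((1 / 2) * (χ (y + unitVec μ) * ‖Du y μ‖) ^ 2 + (13 / 2) * δ ^ 2 * ‖u y‖ ^ 2 +
        (1 / 2) * δ ^ 2 * ‖R y μ (u (y + unitVec μ))‖ ^ 2 + 2 * ‖g y μ‖ ^ 2) =
        (1 / 2) * ∑ y ∈ box z Rr, ∑ μ, (χ (y + unitVec μ) * ‖Du y μ‖) ^ 2 + (13 / 2) * δ ^ 2 * ∑ y ∈ box z Rr, ∑ μ : Fin d, ‖u y‖ ^ 2 +
        (1 / 2) * δ ^ 2 * ∑ y ∈ box z Rr, ∑ μ, ‖u (y + unitVec μ)‖ ^ 2 + 2 * ∑ y ∈ box z Rr, ∑ μ, ‖g y μ‖ ^ 2 := by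
      simp only [Finset.sum_add_distrib, Finset.mul_sum, LinearIsometryEquiv.norm_map]
    rw [e1] at hI
    linarith
  -- the pieces: LHS ≤ I, Σ ‖u‖² terms over the bigger box, Σ ‖u₊‖² by translation
  have hLHS : ∑ y ∈ box z ρ, ∑ μ, ‖R y μ (u (y + unitVec μ)) - u y‖ ^ 2 ≤ ∑ y ∈ box z Rr, ∑ μ, (χ (y + unitVec μ) * ‖Du y μ‖) ^ 2 := by
    have hsub : box z ρ ⊆ box z Rr := box_mono z (by rw [hR]; linarith)
    calc ∑ y ∈ box z ρ, ∑ μ, ‖R y μ (u (y + unitVec μ)) - u y‖ ^ 2 = ∑ y ∈ box z ρ, ∑ μ, (χ (y + unitVec μ) * ‖Du y μ‖) ^ 2 := by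
          refine Finset.sum_congr rfl fun y hy => Finset.sum_congr rfl fun μ _ => ?_
          rw [hχin _ (add_unitVec_mem_box hy μ), one_mul]
      _ ≤ ∑ y ∈ box z Rr, ∑ μ, (χ (y + unitVec μ) * ‖Du y μ‖) ^ 2 :=
          Finset.sum_le_sum_of_subset_of_nonneg hsub fun _ _ _ => Finset.sum_nonneg fun _ _ => sq_nonneg _
  have hU1 : ∑ y ∈ box z Rr, ∑ μ : Fin d, ‖u y‖ ^ 2 ≤ d * ∑ y ∈ box z (ρ + s + 2), ‖u y‖ ^ 2 := by
    have e : ∑ y ∈ box z Rr, ∑ μ : Fin d, ‖u y‖ ^ 2 = d * ∑ y ∈ box z Rr, ‖u y‖ ^ 2 := by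
      rw [Finset.mul_sum]
      refine Finset.sum_congr rfl fun y _ => ?_
      rw [Finset.sum_const, Finset.card_univ, Fintype.card_fin, nsmul_eq_mul]
    rw [e]
    exact mul_le_mul_of_nonneg_left (Finset.sum_le_sum_of_subset_of_nonneg (box_mono z (by rw [hR]; linarith))
      fun _ _ _ => sq_nonneg _) (Nat.cast_nonneg d)
  have hU2 : ∑ y ∈ box z Rr, ∑ μ, ‖u (y + unitVec μ)‖ ^ 2 ≤ d * ∑ y ∈ box z (ρ + s + 2), ‖u y‖ ^ 2 := by
    rw [Finset.sum_comm]
    have : ∀ μ : Fin d, ∑ y ∈ box z Rr, ‖u (y + unitVec μ)‖ ^ 2 ≤ ∑ y ∈ box z (ρ + s + 2), ‖u y‖ ^ 2 := by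
      intro μ
      rw [sum_box_add_right (fun y => ‖u y‖ ^ 2)]
      refine Finset.sum_le_sum_of_subset_of_nonneg (box_subset_box fun i => ?_) fun _ _ _ => sq_nonneg _
      simp only [Pi.add_apply, add_sub_cancel_left]
      rw [hR]
      linarith [abs_unitVec_apply_le μ i]
    calc ∑ μ, ∑ y ∈ box z Rr, ‖u (y + unitVec μ)‖ ^ 2 ≤ ∑ μ : Fin d, ∑ y ∈ box z (ρ + s + 2), ‖u y‖ ^ 2 := Finset.sum_le_sum fun μ _ => this μ
      _ = d * ∑ y ∈ box z (ρ + s + 2), ‖u y‖ ^ 2 := by rw [Finset.sum_const, Finset.card_univ, Fintype.card_fin, nsmul_eq_mul]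
  have hG : ∑ y ∈ box z Rr, ∑ μ, ‖g y μ‖ ^ 2 = ∑ y ∈ box z (ρ + s + 1), ∑ μ, ‖g y μ‖ ^ 2 := by rw [hR]
  have hS : ∑ y ∈ box z Rr, ‖u y‖ * ‖src y‖ = ∑ y ∈ box z (ρ + s + 1), ‖u y‖ * ‖src y‖ := by rw [hR]
  have hUnn : 0 ≤ ∑ y ∈ box z (ρ + s + 2), ‖u y‖ ^ 2 := Finset.sum_nonneg fun _ _ => sq_nonneg _
  have hδ2 : δ ^ 2 = 1 / (s : ℝ) ^ 2 := by rw [hδ]; field_simp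
  calc ∑ y ∈ box z ρ, ∑ μ, ‖R y μ (u (y + unitVec μ)) - u y‖ ^ 2 ≤ ∑ y ∈ box z Rr, ∑ μ, (χ (y + unitVec μ) * ‖Du y μ‖) ^ 2 := hLHS
    _ ≤ 13 * δ ^ 2 * (d * ∑ y ∈ box z (ρ + s + 2), ‖u y‖ ^ 2) + δ ^ 2 * (d * ∑ y ∈ box z (ρ + s + 2), ‖u y‖ ^ 2) +
        4 * ∑ y ∈ box z (ρ + s + 1), ∑ μ, ‖g y μ‖ ^ 2 + 2 * ∑ y ∈ box z (ρ + s + 1), ‖u y‖ * ‖src y‖ := by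
        rw [← hG, ← hS]
        have a1 := mul_le_mul_of_nonneg_left hU1 (by positivity : (0:ℝ) ≤ 13 * δ ^ 2)
        have a2 := mul_le_mul_of_nonneg_left hU2 (by positivity : (0:ℝ) ≤ δ ^ 2)
        linarith
    _ = (14 * d / (s : ℝ) ^ 2) * ∑ y ∈ box z (ρ + s + 2), ‖u y‖ ^ 2 + 4 * ∑ y ∈ box z (ρ + s + 1), ∑ μ, ‖g y μ‖ ^ 2
        + 2 * ∑ y ∈ box z (ρ + s + 1), ‖u y‖ * ‖src y‖ := by
        rw [hδ2]; ring

/-- ★ **Covariant Caccioppoli for `L_R^κ`-harmonic functions** (`g = 0`, `src = 0`): `Σ_{Q_ρ(z)} Σ_μ ‖D_Rμ h‖² ≤ (14d∕s²)·Σ_{Q_{ρ+s+2}(z)} ‖h‖²`.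
[folklore] [cite: Giaquinta1984, Ch. III §2 (2.4) p.77; Balaban1985BackgroundPropagators, (3.23) p.394] -/
theorem covariant_caccioppoli_harmonic (R : Zd d → Fin d → (W ≃ₗᵢ[ℝ] W)) {κ : ℝ} (hκ : 0 ≤ κ) (h : Zd d → W) (z : Zd d) {ρ s : ℤ} (hρ : 0 ≤ ρ) (hs : 1 ≤ s)
    (hEq : ∀ y ∈ box z (ρ + s),
      (∑ μ, ((2 : ℝ) • h y - R y μ (h (y + unitVec μ)) - (R (y - unitVec μ) μ).symm (h (y - unitVec μ)))) + κ • h y = 0) :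
    ∑ y ∈ box z ρ, ∑ μ, ‖R y μ (h (y + unitVec μ)) - h y‖ ^ 2 ≤ (14 * d / (s : ℝ) ^ 2) * ∑ y ∈ box z (ρ + s + 2), ‖h y‖ ^ 2 := by
  have := covariant_caccioppoli R hκ h (fun _ _ => 0) (fun _ => 0) z hρ hs (fun y hy => by rw [hEq y hy]; simp)
  simpa using this

end Summit.QuantumFields.YangMills.Theorems.Prop7CovariantLatticeCaccioppoli

end
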